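import Summits.ResolutionOfSingularities.ResolutionOfSingularities.Theorems.FrobeniusLadderFInjectiveMacaulayficationPencilBlowupLocalCharts
import HarnessLib

/-!
# BED Ω, GLOBAL PATCH (g-b), F6 ALGEBRA: localizations of the pencil ring over a LOCALIZED base are localizations of the pencil ring over the base
# (`S = M⁻¹A` ⇒ every `(S[X]/(uX − v))_𝔔` is some `(A[X]/(uX − v))_{𝔔′}`) — turns the stalk-level FULL hypotheses of ✓ `PencilStalkPackage.fullCl_stalk_of_pair_germ` (pencil rings over
# `𝒪_{X̃,x}`) into statements about the GLOBAL complete-intersection pencil rings of a chart (where the exit tags live) (`g14/F6-DESIGN.md` ADDENDUM (4); crux `FInjectiveMacaulayfication`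
# stmt-ResolutionOfSingularities-15315, chain w45a; seat res-L1-w45a-stub-3 g14)

[OURS · L1 W4.5a] Support file (`--supports stmt-ResolutionOfSingularities-15315 --as helper`); pure commutative algebra; theorems only; no named fact; NOT a statement of any manuscript;
nothing of the crux is proved. AI-written (AI review is weaker than expert review).
* ★ `exists_ringEquiv_loc_pencilQuot` — for `S` a localization of `A` at `M` and `𝔔` a prime of `S[X]/(C u′ X − C v′)` (`u′, v′` the images of `u, v`), there is a prime `𝔔′` of `A[X]/(C u X − C v)` with
  `(S[X]/…)_𝔔 ≃+* (A[X]/…)_{𝔔′}` (✓ Mathlib `Polynomial.isLocalization`, `IsLocalization.of_surjective`, `isLocalization_isLocalization_atPrime_isLocalization`);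
* ★ `fullCl_loc_pencilQuot_of_isLocalization`, `cmCl_loc_pencilQuot_of_isLocalization` — hence FULL / CM of all localizations descends from `A` to `S`.
[cite: StacksProject, Tag 02C5 (localization is transitive); Matsumura1987, §4]
-/

set_option linter.dupNamespace false

noncomputable section

open Polynomial

namespace Summit.ResolutionOfSingularities.ResolutionOfSingularities.Theorems.FInjectiveMacaulayfication.PencilQuotLocalization

open Summit.ResolutionOfSingularities.ResolutionOfSingularities.Theorems.FInjectiveMacaulayfication
open SliceableCentre PencilBlowupLocalCharts

variable {A S : Type} [CommRing A] [CommRing S] [Algebra A S] (M : Submonoid A) [IsLocalization M S] (u v : A)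

/-- The pencil relation maps to the pencil relation. [plumbing] -/
theorem map_pencil : mapRingHom (algebraMap A S) (C u * X - C v) = C (algebraMap A S u) * X - C (algebraMap A S v) := by
  simp only [map_sub, map_mul, Polynomial.map_C, Polynomial.map_X, coe_mapRingHom]

/-- `(C u X − C v)·S[X] = (C u′ X − C v′)`. [plumbing] -/
theorem map_span_pencil : (Ideal.span {C u * X - C v} : Ideal A[X]).map (mapRingHom (algebraMap A S)) =
    Ideal.span {C (algebraMap A S u) * X - C (algebraMap A S v)} := by
  rw [Ideal.map_span, Set.image_singleton, map_pencil]

include M in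
/-- ★ **LOCALIZATIONS OF THE PENCIL RING OVER `M⁻¹A` ARE LOCALIZATIONS OF THE PENCIL RING OVER `A`.** [folklore; cite: StacksProject, Tag 02C5] -/
theorem exists_ringEquiv_loc_pencilQuot (Q : Ideal (S[X] ⧸ Ideal.span {C (algebraMap A S u) * X - C (algebraMap A S v)})) [Q.IsPrime] :
    ∃ (Q' : Ideal (A[X] ⧸ Ideal.span {C u * X - C v})) (_ : Q'.IsPrime),
      Nonempty (Localization.AtPrime Q ≃+* Localization.AtPrime Q') := by
  letI : Algebra A[X] S[X] := Polynomial.algebra A S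
  haveI hL : IsLocalization (M.map (C : A →+* A[X])) S[X] := Polynomial.isLocalization M S
  let I : Ideal A[X] := Ideal.span {C u * X - C v}
  let I' : Ideal S[X] := Ideal.span {C (algebraMap A S u) * X - C (algebraMap A S v)}
  have hII' : I ≤ I'.comap (mapRingHom (algebraMap A S)) := by
    rw [← Ideal.map_le_iff_le_comap]
    exact (map_span_pencil u v).le
  let φ : A[X] ⧸ I →+* S[X] ⧸ I' := Ideal.quotientMap I' (mapRingHom (algebraMap A S)) hII'
  letI : Algebra (A[X] ⧸ I) (S[X] ⧸ I') := φ.toAlgebra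
  have hφ : algebraMap (A[X] ⧸ I) (S[X] ⧸ I') = φ := rfl
  haveI hloc : IsLocalization ((M.map (C : A →+* A[X])).map (Ideal.Quotient.mk I)) (S[X] ⧸ I') := by
    refine IsLocalization.of_surjective (M.map (C : A →+* A[X])) S[X] (Ideal.Quotient.mk I) Ideal.Quotient.mk_surjective
      (Ideal.Quotient.mk I') Ideal.Quotient.mk_surjective ?_ ?_
    · ext x <;> simp [hφ, φ, Polynomial.algebraMap_def]
    · rw [Ideal.mk_ker, Ideal.mk_ker, Polynomial.algebraMap_def]
      exact (map_span_pencil (S := S) u v).ge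
  haveI hT : IsLocalization.AtPrime (Localization.AtPrime Q) (Q.comap (algebraMap (A[X] ⧸ I) (S[X] ⧸ I'))) :=
    IsLocalization.isLocalization_isLocalization_atPrime_isLocalization ((M.map (C : A →+* A[X])).map (Ideal.Quotient.mk I))
      (Localization.AtPrime Q) Q
  haveI : (Q.comap (algebraMap (A[X] ⧸ I) (S[X] ⧸ I'))).IsPrime := Ideal.comap_isPrime _ Q
  exact ⟨Q.comap (algebraMap (A[X] ⧸ I) (S[X] ⧸ I')), inferInstance,
    ⟨(IsLocalization.algEquiv (Q.comap (algebraMap (A[X] ⧸ I) (S[X] ⧸ I'))).primeCompl (Localization.AtPrime Q)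
      (Localization.AtPrime (Q.comap (algebraMap (A[X] ⧸ I) (S[X] ⧸ I'))))).toRingEquiv⟩⟩

include M in
/-- ★ FULL of every localization of the pencil ring descends from `A` to the localized base `S = M⁻¹A`. [OURS · F6 algebra] -/
theorem fullCl_loc_pencilQuot_of_isLocalization (p : ℕ) (h : ∀ (Q' : Ideal (A[X] ⧸ Ideal.span {C u * X - C v})) [Q'.IsPrime], FullCl p (Localization.AtPrime Q')) :
    ∀ (Q : Ideal (S[X] ⧸ Ideal.span {C (algebraMap A S u) * X - C (algebraMap A S v)})) [Q.IsPrime], FullCl p (Localization.AtPrime Q) := by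
  intro Q _
  obtain ⟨Q', hQ', ⟨e⟩⟩ := exists_ringEquiv_loc_pencilQuot M u v Q
  exact fullCl_of_ringEquiv' p e.symm (h Q')

include M in
/-- ★ The same for the CM clause. [OURS · F6 algebra] -/
theorem cmCl_loc_pencilQuot_of_isLocalization (h : ∀ (Q' : Ideal (A[X] ⧸ Ideal.span {C u * X - C v})) [Q'.IsPrime], CMCl (Localization.AtPrime Q')) :
    ∀ (Q : Ideal (S[X] ⧸ Ideal.span {C (algebraMap A S u) * X - C (algebraMap A S v)})) [Q.IsPrime], CMCl (Localization.AtPrime Q) := by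
  intro Q _
  obtain ⟨Q', hQ', ⟨e⟩⟩ := exists_ringEquiv_loc_pencilQuot M u v Q
  exact FiLocusOpenOfAffine.cmClause_of_ringEquiv e.symm (h Q')


include M in
/-- ★ **SHARPER FORM: only primes over `M`-free primes matter.** For `𝔔` a prime of the pencil ring over `S = M⁻¹A`, the prime `𝔔′` of `exists_ringEquiv_loc_pencilQuot` can be taken with
`𝔔′ ∩ A` disjoint from `M` (so for `S = A_P`: `𝔔′ ∩ A ⊆ P`, i.e. `𝔔′` lies over a generization of the point). [folklore; cite: StacksProject, Tag 02C5] -/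
theorem exists_ringEquiv_loc_pencilQuot_disjoint (Q : Ideal (S[X] ⧸ Ideal.span {C (algebraMap A S u) * X - C (algebraMap A S v)})) [Q.IsPrime] :
    ∃ (Q' : Ideal (A[X] ⧸ Ideal.span {C u * X - C v})) (_ : Q'.IsPrime),
      (∀ a ∈ M, (Ideal.Quotient.mk (Ideal.span {C u * X - C v})) (C a) ∉ Q') ∧ Nonempty (Localization.AtPrime Q ≃+* Localization.AtPrime Q') := by
  letI : Algebra A[X] S[X] := Polynomial.algebra A S
  haveI hL : IsLocalization (M.map (C : A →+* A[X])) S[X] := Polynomial.isLocalization M S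
  let I : Ideal A[X] := Ideal.span {C u * X - C v}
  let I' : Ideal S[X] := Ideal.span {C (algebraMap A S u) * X - C (algebraMap A S v)}
  have hII' : I ≤ I'.comap (mapRingHom (algebraMap A S)) := by
    rw [← Ideal.map_le_iff_le_comap]
    exact (map_span_pencil u v).le
  let φ : A[X] ⧸ I →+* S[X] ⧸ I' := Ideal.quotientMap I' (mapRingHom (algebraMap A S)) hII'
  letI : Algebra (A[X] ⧸ I) (S[X] ⧸ I') := φ.toAlgebra
  have hφ : algebraMap (A[X] ⧸ I) (S[X] ⧸ I') = φ := rfl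
  haveI hloc : IsLocalization ((M.map (C : A →+* A[X])).map (Ideal.Quotient.mk I)) (S[X] ⧸ I') := by
    refine IsLocalization.of_surjective (M.map (C : A →+* A[X])) S[X] (Ideal.Quotient.mk I) Ideal.Quotient.mk_surjective
      (Ideal.Quotient.mk I') Ideal.Quotient.mk_surjective ?_ ?_
    · ext x <;> simp [hφ, φ, Polynomial.algebraMap_def]
    · rw [Ideal.mk_ker, Ideal.mk_ker, Polynomial.algebraMap_def]
      exact (map_span_pencil (S := S) u v).ge
  haveI hT : IsLocalization.AtPrime (Localization.AtPrime Q) (Q.comap (algebraMap (A[X] ⧸ I) (S[X] ⧸ I'))) :=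
    IsLocalization.isLocalization_isLocalization_atPrime_isLocalization ((M.map (C : A →+* A[X])).map (Ideal.Quotient.mk I))
      (Localization.AtPrime Q) Q
  haveI : (Q.comap (algebraMap (A[X] ⧸ I) (S[X] ⧸ I'))).IsPrime := Ideal.comap_isPrime _ Q
  refine ⟨Q.comap (algebraMap (A[X] ⧸ I) (S[X] ⧸ I')), inferInstance, fun a ha hmem => ?_,
    ⟨(IsLocalization.algEquiv (Q.comap (algebraMap (A[X] ⧸ I) (S[X] ⧸ I'))).primeCompl (Localization.AtPrime Q)
      (Localization.AtPrime (Q.comap (algebraMap (A[X] ⧸ I) (S[X] ⧸ I'))))).toRingEquiv⟩⟩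
  -- an element of `M` becomes a unit in `S`, hence in `S[X]/I'`, so it cannot lie in the prime `Q`
  rw [Ideal.mem_comap] at hmem
  have hunit : IsUnit (algebraMap (A[X] ⧸ I) (S[X] ⧸ I') ((Ideal.Quotient.mk I) (C a))) :=
    IsLocalization.map_units (S[X] ⧸ I') ⟨(Ideal.Quotient.mk I) (C a), Submonoid.mem_map.mpr ⟨C a, Submonoid.mem_map.mpr ⟨a, ha, rfl⟩, rfl⟩⟩
  exact (Ideal.IsPrime.ne_top inferInstance) (Ideal.eq_top_of_isUnit_mem Q hmem hunit)

include M in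
/-- ★ FULL of every localization of the pencil ring over `S = M⁻¹A` from FULL of the localizations of the pencil ring over `A` at primes disjoint from `M`. [OURS · F6 algebra] -/
theorem fullCl_loc_pencilQuot_of_isLocalization_disjoint (p : ℕ)
    (h : ∀ (Q' : Ideal (A[X] ⧸ Ideal.span {C u * X - C v})) [Q'.IsPrime], (∀ a ∈ M, (Ideal.Quotient.mk (Ideal.span {C u * X - C v})) (C a) ∉ Q') →
      FullCl p (Localization.AtPrime Q')) :
    ∀ (Q : Ideal (S[X] ⧸ Ideal.span {C (algebraMap A S u) * X - C (algebraMap A S v)})) [Q.IsPrime], FullCl p (Localization.AtPrime Q) := by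
  intro Q _
  obtain ⟨Q', hQ', hdisj, ⟨e⟩⟩ := exists_ringEquiv_loc_pencilQuot_disjoint M u v Q
  exact fullCl_of_ringEquiv' p e.symm (h Q' hdisj)

end Summit.ResolutionOfSingularities.ResolutionOfSingularities.Theorems.FInjectiveMacaulayfication.PencilQuotLocalization

end
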